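import Literature.AlgebraicGeometry.HodgeTheory.QuaternionicQuarticDeckChart
import Literature.AlgebraicGeometry.RelativeSpec.FiniteGroupQuotient
import Mathlib.GroupTheory.SpecificGroups.Quaternion
import HarnessLib

/-!
# The action of `Q₈` on the étale chart of the normalised quaternionic quartic cover
# (programme «M1», brick M1-0a, part 2)

Layer `Literature/AlgebraicGeometry/HodgeTheory`. Definitions + proved API (no named fact). Written by the prover
seat `hodge-nonav-prover-Bx` (g19, cell `hodge-nonav`), programme M1 («the deck pair on a smooth projective family
model», memo `PROGRAMME-M1-Bx-g19.md`) for route `HodgeConjecture/Q8SymplecticPowers` (crux K1Q,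
stmt-HodgeConjecture-24190). Sequel of `QuaternionicQuarticDeckChart` (the chart algebra
`DeckRing a = R[u₀, u₁, w, w₁, w₂, v]/(r₁, …, r₇)` and the substitutions `τ₀`, `j₀` by signed permutations with
`τ₀⁴ = 1`, `j₀² = τ₀²`, `τ₀ j₀ τ₀ = j₀` on the polynomial ring, ideal visibly stable). Here:

* `QuaternionGroup.liftQ8` — the presentation `Q₈ = ⟨t, s | t⁴ = 1, s² = t², t s t = s⟩`: such a pair in a
  group defines `QuaternionGroup 2 →* M` with `a 1 ↦ t`, `xa 0 ↦ s` (Mathlib's `QuaternionGroup n` is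
  `⟨a, x | a^{2n} = 1, x² = aⁿ, x⁻¹ a x = a⁻¹⟩`, `xa i = x aⁱ`);
* `tauHom`, `jHom` (the induced endomorphisms of the quotient), the relations `tauHom_pow_four`,
  `jHom_comp_jHom`, `tauHom_comp_jHom_comp_tauHom`, the automorphisms **`tauQ`, `jQ : DeckRing a ≃ₐ[R] DeckRing a`**
  (inverses `τ³`, `j³`) and **`deckActionAlg a : QuaternionGroup 2 →* (DeckRing a ≃ₐ[R] DeckRing a)`**;
* `specAutIso`, `specOverAut`, `specOverAutHom` — [folklore] `σ ↦ Spec σ⁻¹`, the homomorphism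
  `(B ≃ₐ[R] B) →* Aut (Spec B → Spec R)` for any `R`-algebra `B`;
* **`deckChart a := specOver R (DeckRing a)`** and **`deckAction a : RelativeSpec.ActionOver (deckChart a).hom (QuaternionGroup 2)`**
  — the REGULAR action of `Q₈` on the chart over `Spec R`, in the input format of the tree's finite quotient
  `Motives.finiteQuotient` / `RelativeSpec.ActionOver.glued` (used by brick M1-2, the equivariant projective
  completion by normalisation).

Honest scope: explicit commutative algebra for one family of surfaces; nothing here bears on HC.

## References

* [Kollar2007] J. Kollár, Lectures on Resolution of Singularities (2007), §3.3, §3.4.1 («any group action on X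
  lifts to X′» — the action typed here is the one to be lifted in brick M1-3).
* [Hartshorne1977] R. Hartshorne, Algebraic Geometry (1977), II Ex. 2.14 (automorphisms of affine schemes).
-/

noncomputable section

open CategoryTheory AlgebraicGeometry MvPolynomial

/-! ### The presentation `Q₈ = ⟨t, s | t⁴ = 1, s² = t², t s t = s⟩` -/

namespace QuaternionGroup

variable {M : Type*} [Group M] {t s : M}

/-- In a group, `t⁴ = 1` makes `t ^ n` depend only on `n mod 4`. [folklore] -/
private theorem pow_eq_pow_mod_four (ht : t ^ 4 = 1) (n : ℕ) : t ^ n = t ^ (n % 4) := by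
  conv_lhs => rw [← Nat.div_add_mod n 4, pow_add, pow_mul, ht, one_pow, one_mul]

/-- `t ^ (i + j).val = t ^ i.val * t ^ j.val` for `i j : ZMod 4` when `t⁴ = 1`. [folklore] -/
private theorem pow_val_add (ht : t ^ 4 = 1) (i j : ZMod (2 * 2)) :
    t ^ (i + j).val = t ^ i.val * t ^ j.val := by
  rw [ZMod.val_add, ← pow_eq_pow_mod_four ht, pow_add]

/-- From `t s t = s`: `t ^ n * s = s * (t ^ n)⁻¹`. [folklore] -/
private theorem pow_mul_eq_mul_pow_inv (htst : t * s * t = s) (n : ℕ) : t ^ n * s = s * (t ^ n)⁻¹ := by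
  have h1 : t * s = s * t⁻¹ := by
    calc t * s = t * s * t * t⁻¹ := by group
      _ = s * t⁻¹ := by rw [htst]
  induction n with
  | zero => simp
  | succ n ih =>
    calc t ^ (n + 1) * s = t ^ n * (t * s) := by rw [pow_succ, mul_assoc]
      _ = t ^ n * s * t⁻¹ := by rw [h1, mul_assoc]
      _ = s * (t ^ n)⁻¹ * t⁻¹ := by rw [ih]
      _ = s * (t ^ (n + 1))⁻¹ := by rw [pow_succ, mul_inv_rev, mul_assoc]; group

/-- The map `a i ↦ tⁱ`, `xa i ↦ s tⁱ` underlying `liftQ8`. [cite: Kollar2007, §3.4.1] -/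
def liftQ8Fun (t s : M) : QuaternionGroup 2 → M
  | a i => t ^ i.val
  | xa i => s * t ^ i.val

/-- **The presentation of `Q₈`**: elements `t, s` of a group with `t⁴ = 1`, `s² = t²`, `t s t = s` define a
homomorphism `QuaternionGroup 2 →* M`, `a 1 ↦ t`, `xa 0 ↦ s` (Mathlib's `QuaternionGroup n` is
`⟨a, x | a^{2n} = 1, x² = aⁿ, x⁻¹ a x = a⁻¹⟩` with `xa i = x aⁱ`; for the deck group of the quartic multiple
planes `t = τ`, `s = j`). [cite: Kollar2007, §3.4.1] -/
def liftQ8 (t s : M) (ht : t ^ 4 = 1) (hs : s * s = t * t) (htst : t * s * t = s) : QuaternionGroup 2 →* M where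
  toFun := liftQ8Fun t s
  map_one' := by
    change t ^ (0 : ZMod (2 * 2)).val = 1
    simp
  map_mul' := by
    have hval2 : ((2 : ℕ) : ZMod (2 * 2)).val = 2 := by decide
    have key : ∀ i j : ZMod (2 * 2), t ^ (j - i).val = t ^ j.val * (t ^ i.val)⁻¹ := fun i j => by
      rw [eq_mul_inv_iff_mul_eq, ← pow_val_add ht, sub_add_cancel]
    rintro (i | i) (j | j)
    · change t ^ (i + j).val = t ^ i.val * t ^ j.val
      exact pow_val_add ht i j
    · change s * t ^ (j - i).val = t ^ i.val * (s * t ^ j.val)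
      rw [key, ← mul_assoc (t ^ i.val) s, pow_mul_eq_mul_pow_inv htst]
      simp only [mul_assoc]
      congr 1
      exact ((Commute.pow_pow_self t j.val i.val).inv_right).eq
    · change s * t ^ (i + j).val = s * t ^ i.val * t ^ j.val
      rw [pow_val_add ht, mul_assoc]
    · change t ^ ((2 : ℕ) + j - i : ZMod (2 * 2)).val = s * t ^ i.val * (s * t ^ j.val)
      rw [key, pow_val_add ht, hval2, mul_assoc s, ← mul_assoc (t ^ i.val) s, pow_mul_eq_mul_pow_inv htst,
        ← mul_assoc, ← mul_assoc, hs, pow_two]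
      simp only [mul_assoc]
      congr 2
      exact ((Commute.pow_pow_self t j.val i.val).inv_right).eq

/-- `liftQ8` on `a i` is `tⁱ`. [cite: Kollar2007, §3.4.1] -/
@[simp] theorem liftQ8_a (ht : t ^ 4 = 1) (hs : s * s = t * t) (htst : t * s * t = s) (i : ZMod (2 * 2)) :
    liftQ8 t s ht hs htst (a i) = t ^ i.val := rfl

/-- `liftQ8` on `xa i` is `s tⁱ`. [cite: Kollar2007, §3.4.1] -/
@[simp] theorem liftQ8_xa (ht : t ^ 4 = 1) (hs : s * s = t * t) (htst : t * s * t = s) (i : ZMod (2 * 2)) :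
    liftQ8 t s ht hs htst (xa i) = s * t ^ i.val := rfl

/-- `liftQ8` sends the generator `a 1` to `t`. [cite: Kollar2007, §3.4.1] -/
theorem liftQ8_a_one (ht : t ^ 4 = 1) (hs : s * s = t * t) (htst : t * s * t = s) :
    liftQ8 t s ht hs htst (a 1) = t := by
  rw [liftQ8_a]
  have : (1 : ZMod (2 * 2)).val = 1 := by decide
  rw [this, pow_one]

/-- `liftQ8` sends the generator `xa 0` to `s`. [cite: Kollar2007, §3.4.1] -/
theorem liftQ8_xa_zero (ht : t ^ 4 = 1) (hs : s * s = t * t) (htst : t * s * t = s) :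
    liftQ8 t s ht hs htst (xa 0) = s := by
  rw [liftQ8_xa, ZMod.val_zero, pow_zero, mul_one]

end QuaternionGroup

namespace Literature.AlgebraicGeometry.HodgeTheory.Q8Family

universe w

/-! ### The automorphisms `τ`, `j` of the chart algebra -/

section QuotAut

variable {R : Type w} [CommRing R] [Algebra ℂ R] {e : ℕ} (a : CIdx e → R)

/-- `τ` on `DeckRing a` as an `R`-algebra endomorphism (induced by `τ₀`). [cite: Kollar2007, §3.4.1] -/
def tauHom : DeckRing a →ₐ[R] DeckRing a :=
  Ideal.quotientMapₐ (deckIdeal a) (tauPoly R) (deckIdeal_le_comap_tauPoly a)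

omit [Algebra ℂ R] in
/-- `j` on `DeckRing a` as an `R`-algebra endomorphism (induced by `j₀`). [cite: Kollar2007, §3.4.1] -/
def jHom : DeckRing a →ₐ[R] DeckRing a :=
  Ideal.quotientMapₐ (deckIdeal a) (jPoly R) (deckIdeal_le_comap_jPoly a)

/-- `τ` after the quotient map is the quotient map after `τ₀`. [cite: Kollar2007, §3.4.1] -/
@[simp] theorem tauHom_mk (p : MvPolynomial (Fin 6) R) :
    tauHom a (Ideal.Quotient.mk (deckIdeal a) p) = Ideal.Quotient.mk (deckIdeal a) (tauPoly R p) := rfl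

omit [Algebra ℂ R] in
/-- `j` after the quotient map is the quotient map after `j₀`. [cite: Kollar2007, §3.4.1] -/
@[simp] theorem jHom_mk (p : MvPolynomial (Fin 6) R) :
    jHom a (Ideal.Quotient.mk (deckIdeal a) p) = Ideal.Quotient.mk (deckIdeal a) (jPoly R p) := rfl

/-- `τ` after the quotient map, as a composition. [cite: Kollar2007, §3.4.1] -/
theorem tauHom_comp_mkₐ :
    (tauHom a).comp (Ideal.Quotient.mkₐ R (deckIdeal a)) = (Ideal.Quotient.mkₐ R (deckIdeal a)).comp (tauPoly R) :=
  Ideal.quotient_map_comp_mkₐ _ _ _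

omit [Algebra ℂ R] in
/-- `j` after the quotient map, as a composition. [cite: Kollar2007, §3.4.1] -/
theorem jHom_comp_mkₐ :
    (jHom a).comp (Ideal.Quotient.mkₐ R (deckIdeal a)) = (Ideal.Quotient.mkₐ R (deckIdeal a)).comp (jPoly R) :=
  Ideal.quotient_map_comp_mkₐ _ _ _

/-- `τ⁴ = 1` on `DeckRing a`. [cite: Kollar2007, §3.4.1] -/
theorem tauHom_pow_four :
    (tauHom a).comp ((tauHom a).comp ((tauHom a).comp (tauHom a))) = AlgHom.id R _ := by
  apply AlgHom.ext
  intro x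
  obtain ⟨p, rfl⟩ := Ideal.Quotient.mk_surjective x
  have h := DFunLike.congr_fun (tauPoly_pow_four (R := R)) p
  simp only [AlgHom.comp_apply, AlgHom.id_apply] at h
  simp only [AlgHom.comp_apply, AlgHom.id_apply, tauHom_mk, h]

/-- `j ∘ j = τ ∘ τ` on `DeckRing a`. [cite: Kollar2007, §3.4.1] -/
theorem jHom_comp_jHom : (jHom a).comp (jHom a) = (tauHom a).comp (tauHom a) := by
  apply AlgHom.ext
  intro x
  obtain ⟨p, rfl⟩ := Ideal.Quotient.mk_surjective x
  have h := DFunLike.congr_fun (jPoly_comp_jPoly (R := R)) p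
  simp only [AlgHom.comp_apply] at h
  simp only [AlgHom.comp_apply, tauHom_mk, jHom_mk, h]

/-- `τ ∘ j ∘ τ = j` on `DeckRing a`. [cite: Kollar2007, §3.4.1] -/
theorem tauHom_comp_jHom_comp_tauHom : (tauHom a).comp ((jHom a).comp (tauHom a)) = jHom a := by
  apply AlgHom.ext
  intro x
  obtain ⟨p, rfl⟩ := Ideal.Quotient.mk_surjective x
  have h := DFunLike.congr_fun (tauPoly_comp_jPoly_comp_tauPoly (R := R)) p
  simp only [AlgHom.comp_apply] at h
  simp only [AlgHom.comp_apply, tauHom_mk, jHom_mk, h]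

/-- `τ³ ∘ τ = 1`. [cite: Kollar2007, §3.4.1] -/
private theorem tauHom3_comp_tauHom :
    ((tauHom a).comp ((tauHom a).comp (tauHom a))).comp (tauHom a) = AlgHom.id R _ := by
  simp only [AlgHom.comp_assoc, tauHom_pow_four]

/-- `τ ∘ τ³ = 1`. [cite: Kollar2007, §3.4.1] -/
private theorem tauHom_comp_tauHom3 :
    (tauHom a).comp ((tauHom a).comp ((tauHom a).comp (tauHom a))) = AlgHom.id R _ := tauHom_pow_four a

/-- **`τ : DeckRing a ≃ₐ[R] DeckRing a`** (inverse `τ³`). [cite: Kollar2007, §3.4.1] -/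
def tauQ : DeckRing a ≃ₐ[R] DeckRing a :=
  AlgEquiv.ofAlgHom (tauHom a) ((tauHom a).comp ((tauHom a).comp (tauHom a))) (tauHom_comp_tauHom3 a)
    (tauHom3_comp_tauHom a)

/-- `j⁴ = 1` on `DeckRing a` (`j² = τ²`). [cite: Kollar2007, §3.4.1] -/
theorem jHom_pow_four : (jHom a).comp ((jHom a).comp ((jHom a).comp (jHom a))) = AlgHom.id R _ := by
  rw [← AlgHom.comp_assoc (jHom a) (jHom a), jHom_comp_jHom, AlgHom.comp_assoc, tauHom_pow_four]

/-- **`j : DeckRing a ≃ₐ[R] DeckRing a`** (inverse `j³`). [cite: Kollar2007, §3.4.1] -/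
def jQ : DeckRing a ≃ₐ[R] DeckRing a :=
  AlgEquiv.ofAlgHom (jHom a) ((jHom a).comp ((jHom a).comp (jHom a))) (jHom_pow_four a)
    (by simpa only [AlgHom.comp_assoc] using jHom_pow_four a)

/-- The underlying algebra hom of `tauQ` is `tauHom`. [cite: Kollar2007, §3.4.1] -/
@[simp] theorem coe_tauQ : (tauQ a : DeckRing a →ₐ[R] DeckRing a) = tauHom a := rfl

/-- The underlying algebra hom of `jQ` is `jHom`. [cite: Kollar2007, §3.4.1] -/
@[simp] theorem coe_jQ : (jQ a : DeckRing a →ₐ[R] DeckRing a) = jHom a := rfl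

/-- `tauQ` acts as `tauHom`. [cite: Kollar2007, §3.4.1] -/
@[simp] theorem tauQ_apply (x : DeckRing a) : tauQ a x = tauHom a x := rfl

/-- `jQ` acts as `jHom`. [cite: Kollar2007, §3.4.1] -/
@[simp] theorem jQ_apply (x : DeckRing a) : jQ a x = jHom a x := rfl

/-- `τ⁴ = 1` in the automorphism group. [cite: Kollar2007, §3.4.1] -/
theorem tauQ_pow_four : tauQ a ^ 4 = 1 := by
  ext x
  simp only [pow_succ, pow_zero, one_mul, AlgEquiv.mul_apply, AlgEquiv.one_apply, tauQ_apply]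
  exact DFunLike.congr_fun (tauHom_pow_four a) x

/-- `j j = τ τ` in the automorphism group. [cite: Kollar2007, §3.4.1] -/
theorem jQ_mul_jQ : jQ a * jQ a = tauQ a * tauQ a := by
  ext x
  simp only [AlgEquiv.mul_apply, tauQ_apply, jQ_apply]
  exact DFunLike.congr_fun (jHom_comp_jHom a) x

/-- `τ j τ = j` in the automorphism group. [cite: Kollar2007, §3.4.1] -/
theorem tauQ_mul_jQ_mul_tauQ : tauQ a * jQ a * tauQ a = jQ a := by
  ext x
  simp only [AlgEquiv.mul_apply, tauQ_apply, jQ_apply]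
  exact DFunLike.congr_fun (tauHom_comp_jHom_comp_tauHom a) x

/-- **The action of `Q₈` on the chart algebra**: `a 1 ↦ τ`, `xa 0 ↦ j`. [cite: Kollar2007, §3.4.1] -/
def deckActionAlg : QuaternionGroup 2 →* (DeckRing a ≃ₐ[R] DeckRing a) :=
  QuaternionGroup.liftQ8 (tauQ a) (jQ a) (tauQ_pow_four a) (jQ_mul_jQ a) (tauQ_mul_jQ_mul_tauQ a)

/-- `deckActionAlg (a 1) = τ`. [cite: Kollar2007, §3.4.1] -/
theorem deckActionAlg_a_one : deckActionAlg a (QuaternionGroup.a 1) = tauQ a :=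
  QuaternionGroup.liftQ8_a_one _ _ _

/-- `deckActionAlg (xa 0) = j`. [cite: Kollar2007, §3.4.1] -/
theorem deckActionAlg_xa_zero : deckActionAlg a (QuaternionGroup.xa 0) = jQ a :=
  QuaternionGroup.liftQ8_xa_zero _ _ _

end QuotAut

/-! ### The chart as a scheme over `Spec R` with its action of `Q₈` -/

section SchemeAction

open Literature.AlgebraicGeometry.Motives Literature.AlgebraicGeometry.RelativeSpec

variable {R : Type w} [CommRing R]

/-- `σ⁻¹ ∘ σ = id` as ring homomorphisms. [folklore] -/
private theorem symm_comp_self (B : Type w) [CommRing B] [Algebra R B] (σ : B ≃ₐ[R] B) :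
    (σ.symm : B →+* B).comp (σ : B →+* B) = RingHom.id B :=
  RingHom.ext fun x => σ.symm_apply_apply x

/-- `σ ∘ σ⁻¹ = id` as ring homomorphisms. [folklore] -/
private theorem self_comp_symm (B : Type w) [CommRing B] [Algebra R B] (σ : B ≃ₐ[R] B) :
    (σ : B →+* B).comp (σ.symm : B →+* B) = RingHom.id B :=
  RingHom.ext fun x => σ.apply_symm_apply x

/-- `Spec` of an `R`-algebra automorphism `σ` of `B` as an automorphism of the scheme `Spec B` (underlying
morphism `Spec σ⁻¹`, inverse `Spec σ`). [cite: Hartshorne1977, II Prop. 2.3] -/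
def specAutIso (B : Type w) [CommRing B] [Algebra R B] (σ : B ≃ₐ[R] B) :
    Spec (CommRingCat.of B) ≅ Spec (CommRingCat.of B) where
  hom := Spec.map (CommRingCat.ofHom (σ.symm : B →+* B))
  inv := Spec.map (CommRingCat.ofHom (σ : B →+* B))
  hom_inv_id := by
    rw [← Spec.map_comp, ← CommRingCat.ofHom_comp, symm_comp_self, CommRingCat.ofHom_id, Spec.map_id]
  inv_hom_id := by
    rw [← Spec.map_comp, ← CommRingCat.ofHom_comp, self_comp_symm, CommRingCat.ofHom_id, Spec.map_id]

/-- `Spec σ⁻¹` as an automorphism of the `R`-scheme `Spec B → Spec R` (so that `σ ↦ Spec σ⁻¹` is a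
homomorphism). [cite: Hartshorne1977, II Prop. 2.3] -/
def specOverAut (B : Type w) [CommRing B] [Algebra R B] (σ : B ≃ₐ[R] B) : specOver R B ≅ specOver R B :=
  Over.isoMk (specAutIso B σ) (by
    change Spec.map _ ≫ Spec.map (CommRingCat.ofHom (algebraMap R B)) = Spec.map (CommRingCat.ofHom (algebraMap R B))
    rw [← Spec.map_comp, ← CommRingCat.ofHom_comp]
    congr 2
    exact σ.symm.toAlgHom.comp_algebraMap)

/-- The underlying morphism of `specOverAut B σ` is `Spec σ⁻¹`. [cite: Hartshorne1977, II Prop. 2.3 (morphisms of affine schemes are `Spec` of ring maps)] -/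
@[simp] theorem specOverAut_hom_left (B : Type w) [CommRing B] [Algebra R B] (σ : B ≃ₐ[R] B) :
    (specOverAut B σ).hom.left = Spec.map (CommRingCat.ofHom (σ.symm : B →+* B)) := rfl

/-- `(σ τ)⁻¹ = τ⁻¹ σ⁻¹` as ring homomorphisms. [folklore] -/
private theorem coe_mul_symm (B : Type w) [CommRing B] [Algebra R B] (σ τ : B ≃ₐ[R] B) :
    ((σ * τ).symm : B →+* B) = (τ.symm : B →+* B).comp (σ.symm : B →+* B) :=
  RingHom.ext fun _ => rfl

/-- `σ ↦ Spec σ⁻¹` as a homomorphism `(B ≃ₐ[R] B) →* Aut (Spec B / Spec R)`. [cite: Hartshorne1977, II Prop. 2.3] -/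
def specOverAutHom (B : Type w) [CommRing B] [Algebra R B] : (B ≃ₐ[R] B) →* Aut (specOver R B) where
  toFun := specOverAut B
  map_one' := by
    ext : 1
    ext : 1
    rw [specOverAut_hom_left]
    change Spec.map (CommRingCat.ofHom (RingHom.id B)) = 𝟙 (Spec (CommRingCat.of B))
    rw [CommRingCat.ofHom_id]; exact Spec.map_id _
  map_mul' σ τ := by
    ext : 1
    ext : 1
    rw [specOverAut_hom_left, Aut.Aut_mul_def, Iso.trans_hom, Over.comp_left, specOverAut_hom_left,
      specOverAut_hom_left, coe_mul_symm, CommRingCat.ofHom_comp]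
    exact Spec.map_comp _ _

variable [Algebra ℂ R] {e : ℕ} (a : CIdx e → R)

/-- **The étale chart of the normalised quaternionic quartic cover as a scheme over `Spec R`.**
[cite: Kollar2007, §3.3] -/
abbrev deckChart : SchemeOver R := specOver R (DeckRing a)

/-- **The regular action of `Q₈` on the chart OVER `Spec R`** (`a 1 ↦ Spec τ⁻¹`, `xa 0 ↦ Spec j⁻¹`), in the
tree's format `RelativeSpec.ActionOver` (the input of `Motives.finiteQuotient`). [cite: Kollar2007, §3.4.1] -/
def deckAction : ActionOver (deckChart a).hom (QuaternionGroup 2) where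
  aut := ((Over.forget _).mapAut (deckChart a)).comp ((specOverAutHom (DeckRing a)).comp (deckActionAlg a))
  aut_comp g := Over.w (((specOverAutHom (DeckRing a)).comp (deckActionAlg a) g)).hom

/-- The automorphism by which `g` acts is `Spec` of the inverse algebra automorphism. [cite: Kollar2007, §3.4.1] -/
theorem deckAction_aut_hom (g : QuaternionGroup 2) :
    ((deckAction a).aut g).hom =
      Spec.map (CommRingCat.ofHom ((deckActionAlg a g).symm : DeckRing a →+* DeckRing a)) := rfl

/-- `τ` acts by `Spec τ³ = Spec τ⁻¹`; in particular `a (-1) = a 3` acts by `Spec τ`. [cite: Kollar2007, §3.4.1] -/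
theorem deckAction_aut_a_one_hom :
    ((deckAction a).aut (QuaternionGroup.a 1)).hom =
      Spec.map (CommRingCat.ofHom ((tauQ a).symm : DeckRing a →+* DeckRing a)) := by
  rw [deckAction_aut_hom, deckActionAlg_a_one]

/-- `j` acts by `Spec j⁻¹`. [cite: Kollar2007, §3.4.1] -/
theorem deckAction_aut_xa_zero_hom :
    ((deckAction a).aut (QuaternionGroup.xa 0)).hom =
      Spec.map (CommRingCat.ofHom ((jQ a).symm : DeckRing a →+* DeckRing a)) := by
  rw [deckAction_aut_hom, deckActionAlg_xa_zero]

end SchemeAction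

end Literature.AlgebraicGeometry.HodgeTheory.Q8Family

end
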